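import Literature.RepresentationTheory.HarrisKudlaSweet1996.SplittingCharactersCM
import Literature.NumberTheory.GelbartRogawski1991.UnitaryDualPairThetaKernelCMTwist
import Literature.RepresentationTheory.CentralCharacterQuotient
import HarnessLib

/-!
# Liu 2021 ↔ Gan–Ichino 2016 ↔ Harris–Kudla–Sweet 1996: the splitting / character CONVENTIONS of the
# oscillator representation `ω(μ, ε, χ)` of a unitary dual pair — a dictionary, and its kernel part at the
# tree's model `ω_ψ ∘ (s_pair ⊗ η)`

Topic `RepresentationTheory/Liu2021`; namespace `Literature.RepresentationTheory.Liu2021`.  KERNEL ONLY: definitions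
and proved lemmas, **no named fact, no `Prop`-valued record, 0 proof holes**; every `[cite: …]` tag is provenance of a
DEFINITION or of the printed sentence a lemma transcribes.  Written for the Hodge/Picard cells' registry row
"N-i1-match" (`ω_ψ ∘ s ∘ ι` restricted to `U(W_i)(𝐀) × U(V)(𝐀)` with the Gelbart–Rogawski splitting "= Liu's
`ω(μ, ε, χ)` with his §4.1 / App. D conventions"): it fixes, between the three printed convention systems below and
the tree's constructed model, WHICH identifications are definitional (typed here), which are one-line kernel
computations (proved here), and which are printed sentences about objects the tree does not have (quoted, not typed).

## The three printed convention systems (verbatim; `[corpus:key pNNNN Lnn]` = held text, page/line)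

**[Liu2021]** Y. Liu, *Fourier–Jacobi cycles and arithmetic relative trace formula*, Camb. J. Math. 9 (2021) =
arXiv:2102.11518 (`paper:arxiv-2102.11518`; author's TeX `FJcycle.tex`; arXiv numbering).
* §1 Notation [p0010 L55 = TeX l. 1132]: "Denote by `ψ_ℚ : ℚ\𝔸 → ℂ^×` the character, uniquely determined by the
  properties that `ψ_ℚ(x) = exp(2πix)` for `x ∈ ℝ` and that `ψ_ℚ` is trivial on `Ẑ`. Put `ψ_k := ψ_ℚ ∘ Tr_{k/ℚ}`,
  which we call the *standard additive character* for `k`."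
* App. B, the paragraph after Remark B.3 [p0044 L32 = TeX l. 4257]: "Let `V, ( , )_V` be a (non-degenerate)
  hermitian space over `E` … of rank `n` and let `W, ⟨ , ⟩_W` be a (non-degenerate) skew-hermitian space over `E` …
  of rank `m`. Let `G := U(V)` and `H := U(W)` … We form the symplectic space `Res_{E/F} V ⊗_E W`, and let
  `Mp(Res_{E/F} V ⊗_E W)` be the metaplectic cover of `Sp(Res_{E/F} V ⊗_E W)(𝔸_F)` with center `ℂ¹`. Then we have
  the oscillator representation `ω` of `Mp(Res_{E/F} V ⊗_E W)` with respect to the standard additive character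
  `ψ_F`. [footnote: In this article, we will always use `ψ_F` to form oscillator representations …] Let
  `μ = (μ_V, μ_W)` be a pair of splitting characters for `(V, W)`, that is, `(μ_V, μ_W)` is a pair of automorphic
  characters of `𝔸_E^×` satisfying `μ_V|_{𝔸_F^×} = μ_{E/F}^m` and `μ_W|_{𝔸_F^×} = μ_{E/F}^n`. Then it induces an
  embedding `ι_μ : G(𝔸_F) × H(𝔸_F) ↪ Mp(Res_{E/F} V ⊗_E W)`. By restriction, we obtain the Weil representation
  `ω_μ := ω ∘ ι_μ` of `G(𝔸_F) × H(𝔸_F)`."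
* App. D §D.1 (= arXiv §10.1), Steps 1–3 [p0056 L10–L18 = TeX ll. 5216–5224] (`V` hermitian of rank `n ≥ 2` over the
  étale rank-2 `F`-algebra `E`, `F` local, char `≠ 2`): "[Step 1] Choose an element `ε ∈ E^{−×}/N_{E/F}E^×`. Let
  `V_ε` be the underlying `F`-vector space of `V` equipped with the form `Tr_{E/F} ε( , )_V`, which becomes a
  symplectic space. … we have the oscillator representation `ω(ε)` of `Mp(V_ε)` using the standard additive
  character `ψ_F`. [Step 2] Choose a character `μ : E^× → ℂ¹` such that `μ|_{F^×}` is the unique character whose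
  kernel is exactly `N_{E/F}E^×`. Then we have the induced homomorphism `ι_μ : U(V) → Mp(V_ε)` (see, for example,
  [HKS]*Section 1). Put `ω(μ, ε) := ω(ε) ∘ ι_μ`. [Step 3] Choose a character `χ : E¹ → ℂ¹`. Let `ω(μ, ε, χ)` be the
  maximal quotient of the representation `ω(ε, μ)` of `U(V)` with central character `χ`."  Globally, Def. 4.11
  [p0020 L29–42]: an *adèlic oscillator triple* `(μ, ε, χ)` = (a conjugate symplectic automorphic character `μ = ⊗μ_v`
  (Def. 4.1: "`μ|_{𝔸_F^×} = μ_{E/F}`"), a collection `ε = (ε_v)_v` over the NON-archimedean `v`, an automorphic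
  character `χ = ⊗χ_v : E¹\(𝔸_E^∞)¹ → ℂ^×`), and `ω(μ, ε, χ) := ⊗'_v ω(μ_v, ε_v, χ_v)`, "an irreducible admissible
  representation of `G(𝔸_F^∞)`" (FINITE adèles).
**[GanIchino2016]** W. T. Gan, A. Ichino, *The Gross–Prasad conjecture and local theta correspondence*, Invent. Math.
206 (2016) = arXiv:1409.6824 (`paper:arxiv-1409.6824`), §4.1 "Weil representations" [p0010 L5–26]: "Let `V` be a
Hermitian space and `W` a skew-Hermitian space. To consider the theta correspondence for the reductive dual pair
`U(V) × U(W)`, one requires certain additional data: a nontrivial additive character `ψ` of `F`; a pair of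
characters `χ_V` and `χ_W` of `E^×` such that `χ_V|_{F^×} = ω_{E/F}^{dim V}` and `χ_W|_{F^×} = ω_{E/F}^{dim W}`. One
way to fix such a pair is simply to fix a character `χ` of `E^×` such that `χ|_{F^×} = ω_{E/F}` and then set
`χ_V = χ^{dim V}` and `χ_W = χ^{dim W}`. a trace zero element `δ ∈ E^×`. To elaborate, the tensor product `V ⊗ W` has
a natural symplectic form defined by `⟨v₁ ⊗ w₁, v₂ ⊗ w₂⟩ = Tr_{E/F}(⟨v₁, v₂⟩_V · ⟨w₁, w₂⟩_W)`. … The data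
`(ψ, χ_V, χ_W, δ)` then allows one to specify a splitting of the metaplectic cover over `U(V) × U(W)`, as shown in
[k], [hks]. In fact, it does not depend on the choice of `δ`. Hence, we have a Weil representation
`ω_{ψ,χ_V,χ_W,V,W}` of `U(V) × U(W)`."
**[HarrisKudlaSweet1996]** M. Harris, S. Kudla, W. J. Sweet, *Theta dichotomy for unitary groups*, JAMS 9 (1996)
(AMS PDF, page `p00NN` = journal p. `940+NN`; text pages materialised by the pub-hodgecm cell under the key
`paper:url-7675555c1c34` — the doi route is paywalled, acquisition acq-04821): §1 (1.1)–(1.2) p. 950 [p0010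
L59–67]: "Let `W, ⟨ , ⟩` (resp. `V, ( , )`) be a non-degenerate skew-Hermitian (resp. Hermitian) space over `E` with
`dim_E W = n` (resp. `dim_E V = m`). Let `𝕎 = V ⊗_E W` (1.1) with the symplectic form
`⟨⟨ , ⟩⟩ = ½ tr_{E/F}(( , ) ⊗ ⟨ , ⟩^τ)`, (1.2) as usual" [the display's layout reconstructed from the
extraction]; p. 951 [p0011 L11–37]: "We will begin with the group `G(W)`. For a fixed Hermitian space `V`, let
`ι_V : G(W) → Sp(𝕎)` (1.4) be the natural homomorphism. If `dim_E V = m`, we choose a character `χ = χ_V` of `E^×`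
such that `χ_V|_{F^×} = ε^m_{E/F}`, (1.5) … This choice determines a lift `ι̃_{V,χ_V} : G(W) → Mp(𝕎)` (1.6) … Note
that two choices `χ₁` and `χ₂` of `χ_V` differ by a character `μ` of `E^×` which is trivial on `F^×`, i.e.,
`χ₂ = μχ₁`. Then `μ` defines a character `μ′` on `E¹` by `μ′(x/x̄) = μ(x)`, (1.7) and we have
`ι̃_{V,χ₂} = (μ′ ∘ det) · ι̃_{V,χ₁}`, (1.8) where `μ′ ∘ det` takes values in the central `ℂ¹` in `Mp(𝕎)`";
(1.14)–(1.16) p. 952 are the tree's `HarrisKudlaSweet1996.HKSSplittingDatum.beta / gammaRV` (`Splittings.lean`).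
**[GelbartRogawski1991]** §3.1 Remark p. 457 L4–8 (quoted in the tree's record file `CompatibleSplitting.lean`): "a
choice of `s` is equivalent to a choice of Hecke character of `E` whose restriction to `F` is `ω_{E/F}`, once `ψ` is
fixed" — and L9–13: two compatible splittings differ by an automorphic character with values in the central `ℂ*`.

## THE DICTIONARY (five slots), and what this file does with each

(idx) **Which character splits which group.**  HKS (1.5)–(1.6) and GI §4.1 index the character by the PARTNER
space: `χ_V` (`χ_V| = ε^{dim V}`) determines the splitting of `G(W) = U(W)`, `χ_W` that of `U(V)`.  Liu App. B indexes
it by the GROUP: his `μ_V` carries the parity `m = rank W` — the parity (1.5) demands of the character splitting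
`G = U(V)` — and `μ_W` the parity `n = rank V`.  So **Liu `(μ_V, μ_W)` = GI / HKS `(χ_W, χ_V)`** (a SWAP of slots),
and GI's recipe "`χ_V = χ^{dim V}`, `χ_W = χ^{dim W}`" reads `μ_V = χ^m`, `μ_W = χ^n`.  DEFINITIONAL — typed here over
the tree's global (1.5)-predicate `HarrisKudlaSweet1996.IsSplittingChar L k μ` (`μ|_{𝕀_{L⁺}} = ε_{L/L⁺}^k`) as the
data structure `SplittingPair L n m` with `equivGI : SplittingPair L n m ≃ SplittingCharacters L n m` (the tree's
GI-labelled structure), `ofOne` / `toGI_ofOne` (= the tree's `SplittingCharacters.ofOne`, `rfl`) — §1.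
(μ) **Liu's single `μ` of App. D / Def. 4.11** (`μ| = μ_{E/F}`, "conjugate symplectic") is the `μ_V`-slot of the
App. B pair for `(V, W₁)`, `W₁` the skew-hermitian LINE `(E, ε)` of Step 1 (`m = 1`), i.e. GI's `χ_{W₁}`, for EVERY
rank `n` of `V`; in the tree: `IsOscillatorChar L μ := IsSplittingChar L 1 μ` ⟺ `IsConjugateSymplectic` (the tree's
[Liu2021, Def. 4.1] predicate, `SplittingCharactersCM`) — §2, with the parity table of the cells' pairs
(`(n, m) = (3, 1)`: both members oscillator characters; `(3, 2)`: `μ_V` conjugate orthogonal).  DEFINITIONAL.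
WHAT IS **NOT** TYPED in this slot: the sentence "the restriction of a Gelbart–Rogawski compatible splitting `s` of
`U(V ⊗ W)(𝐀)` to `U(V)(𝐀)` IS Kudla's `ι_μ` for a unique Hecke character `μ` with `μ| = ε^{rank W}`" — this is
print ([GelbartRogawski1991, Remark p. 457 L4–8] with [HarrisKudlaSweet1996, (1.8)] and Liu's Step 2 "see [HKS]
Section 1"), but the tree has no object `ι_μ` (Kudla's splitting needs the Rao / Leray / Weil-index vocabulary —
`Splittings.lean` types only the SHAPE (1.15) of `β_{V,χ}`), so the model's splitting `splittingOf hGR`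
(`GelbartRogawski1991.UnitaryDualPair`, a choice from Prop. 3.1.1) carries NO name `μ`; the sentence stays the
object-match duty (om1) "SPLIT-CONSISTENCY" printed in `Liu2021/LocalOscillatorRepresentation.lean` §3.
(ψ) **Additive characters.**  Liu's `ψ_F` is `exp(+2πi Tr ·)` at `∞` and trivial on `∏_v 𝒪_v` (quotation above);
the tree's model `Weil1964.adelicMpCont.omega` is the Schrödinger representation for `ψ = Automorphic.adeleAddChar L⁺`
(`Weil1964/AdelicHeisenbergSchrodinger.lean`), Tate's `e^{2πiΛ}` with "`Λ_∞(x) = −Tr x`" (docstring of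
`Automorphic.adeleAddChar`, `AdelicAdditiveCharacter.lean`): `exp(−2πi Tr ·)` at `∞`, trivial on `∏_v 𝒪_v` and on
`L⁺`.  Both are characters of `𝔸/L⁺` trivial on `L⁺ + (L⁺_∞ × ∏_v 𝒪_v) = 𝔸` after multiplying one by the other, so
**`ψ_tree = ψ_Liu⁻¹`** exactly.  RECORDED here (docstring level; the two definitions are the evidence), not a lemma:
Liu's `ω(ε)` is not a tree object.  Standard consequence to keep in mind (NOT asserted): `ω_{ψ⁻¹}` of a symplectic
space is `ω_ψ` of the space with the negated form, so a model built with `ψ_tree` on Liu's `V_ε` is, in Liu's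
`ψ_F`-parametrisation, attached to the class of `−ε` — modulo the (unprinted, on Liu's side) normalisation of the
Heisenberg group law / Schrödinger model; this residual is slot (ψ) of N-i1-match and is NOT decided in the tree.
(ε) **Liu's `ε` versus the model's form.**  The tree's dual-pair model puts on `Res_{E/F}(V ⊗ W)` the alternating
form `im_δ(h_V ⊗ h_W)` of the quadratic coordinates `E = F ⊕ Fδ`, `δ² = d` (`UnitaryGroupSymplecticEmbedding`:
`im_hermForm_map`, `trace_delta_mul`; the CM datum uses `δ = imagUnit L`), whereas Liu's `V_ε` carries
`Tr_{E/F} ε( , )_V`, GI's `V ⊗ W` carries `Tr_{E/F}(⟨ , ⟩_V · ⟨ , ⟩_W)` and HKS's `𝕎` carries `½ tr(( , ) ⊗ ⟨ , ⟩^τ)`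
(three printed normalisations differing by `½` and a conjugation).  PROVED here (§3): with
`epsilonOf δ d a := (a/2d)·δ = a/(2δ)` one has `Tr_{E/F}(ε z) = a · im_δ(z)` (`epsilonOf_mul_add_conj`) and, on
vectors, the tree's `alt (polar β_T) (reIm x) (reIm y)` read in `E` IS `Tr_{E/F}(ε · h_T(x, y))`
(`algebraMap_alt_polar_eq_trace`, `…_smul_…` for the line-scaled Gram matrix `a • T`): for the pair `(V, ⟨a⟩)` the
model's symplectic space is Liu's `V_ε` with **`ε = a/(2δ)`**, as FORMS, on the nose (`c ε = −ε`: `conj_epsilonOf`).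
(χ) **Liu's central character `χ` versus the theta-lift index `χ′`.**  In the model the pair splitting is the
RESTRICTION of one homomorphism on `U(V ⊗ W)(𝐀)`, so it is `1` on the anti-diagonal centre
`Z⁻ = {(u · 1_V, u⁻¹ · 1_W)}` (tree `cmPairSplitting_center`), and the `K_∞`-normalised model `ω_ψ ∘ (s_pair ⊗ η)`
(`cmPairRepTwist`) is the scalar `η(u · 1_V, u⁻¹ · 1_W)` there (`cmPairRepTwist_center`).  PROVED here (§4):
`centerTwist η = η ∘ antiDiag =: η_Z` (the `β` of the tree's predicate `CenterCharEq`, `centerCharEq_iff`); the centre of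
`U(V)` acts as the centre of `U(W)` twisted by `η_Z` (`cmPairRepTwist_centerV`); hence Liu's Step-3 `χ`-augmentation
for `Z(U(V))` EQUALS the `(χ η_Z⁻¹)`-augmentation for `Z(U(W))` (`augmentation_centerV_eq`) and the two maximal
quotients coincide: **Liu's `χ` = `χ′ · η_Z`**, and `χ = χ′` for the un-normalised Gelbart–Rogawski splitting
(`…_one`).  Liu's Step-3 operation at the model is `modelCentralQuotientRep` (the tree's
`CentralCharacterQuotient.quotRep`), with `modelCentralQuotientRep_center` and `ker_mkQ_centerV_eq`.  (For a hermitian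
LINE `W₁`, `U(W₁)(𝐀) = U(1)(𝐀)` IS its centre, tree `UnitaryGroupAdelicOneTorus` / `UnitaryGroupAdelicLineTorus`.)
SCOPE NOTE: Liu's `ω(μ, ε, χ)` is a representation of `G(𝔸_F^∞)` (finite adèles, Def. 4.11); the model is over the
full adèles `𝔸_{L⁺}` — the same Step-3 operation; its archimedean component is the business of the `K_∞`-type rows,
not of this dictionary.

**Verdict for the registry row N-i1-match** (recorded, not adjudicated here): slots (idx), (μ)-conditions, (ε),
(χ) are DEFINITIONAL / kernel and typed in this file (count 0); the residuals are (μ)-"`s|_{U(V)} = ι_μ`" (print: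
GR91 Remark p. 457 + HKS (1.8) + Liu Step 2; no tree object) and (ψ)-normalisation (Liu does not print his
Heisenberg convention) — convention-comparison SENTENCES already carried by the docstrings of the N-d2 record
(`CompatibleSplitting.lean`) and of `LocalOscillatorRepresentation.lean` §3 (om1); no new record is proposed.

## Contents

§1 `SplittingPair` + `equivGI` / `ofOne` (slot (idx)); §2 `IsOscillatorChar` and the parity lemmas (slot (μ),
conditions only); §3 `epsilonOf` and the form identities (slot (ε); generic quadratic `E/F` with coordinates
`IsQuadraticCoordinates (algebraMap F E) Ψ δ d`, e.g. the tree's `isQuadraticCoordinates_rat`); §4 `antiDiag`,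
`centerTwist`, `cmPairRepTwist_centerV`, `augmentation_centerV_eq`, `modelCentralQuotientRep` (slot (χ), at the CM model
of `GelbartRogawski1991.UnitaryDualPair` in the currency `CMAdelic / CMAdelicOne / CMCenter / CMSchwartz` of
`UnitaryDualPairThetaKernelCMTwist`); §5 the `example`s of record at the Picard pair `(N, M) = (3, 1)`.

NOT here: any statement about Liu's `ω(ε)`, `ι_μ`, `ω(μ, ε, χ)` as objects (not in the tree), Kudla's splitting
property [Kudla1994, Thm. 3.1], the local components of the model, archimedean types.

## References

* [Liu2021] Y. Liu, Camb. J. Math. 9 (2021) 1–147 = arXiv:2102.11518: §1 Notation (TeX l. 1132), Def. 4.1, Def. 4.11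
  (p. 20), App. B ¶ after Remark B.3 (p. 44, TeX l. 4257), App. D §D.1 Steps 1–3 (p. 56, TeX ll. 5216–5224).
* [GanIchino2016] W. T. Gan, A. Ichino, Invent. Math. 206 (2016) 705–799 = arXiv:1409.6824, §4.1.
* [HarrisKudlaSweet1996] M. Harris, S. S. Kudla, W. J. Sweet, J. Amer. Math. Soc. 9 (1996) 941–1004, §1 (1.1)–(1.8)
  pp. 950–951, (1.14)–(1.16) p. 952.
* [GelbartRogawski1991] S. Gelbart, J. Rogawski, Invent. Math. 105 (1991), §3.1 Prop. 3.1.1 p. 455, Remark p. 457.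
* [Kudla1994] S. S. Kudla, Israel J. Math. 87 (1994) 361–401 (GI's [k], HKS's [22], Liu's "[HKS] Section 1").
* [CasselsFrohlichANT1967] Ch. XV (Tate), §2.2 (the character `e^{2πiΛ}`, "note the minus sign").
-/

set_option autoImplicit false

noncomputable section

open NumberField

namespace Literature.RepresentationTheory.Liu2021

open _root_.Literature.RepresentationTheory.HarrisKudlaSweet1996
open _root_.Literature.NumberTheory.GaloisRepresentations (HeckeCharacter ideleGroup)
open _root_.Literature.NumberTheory.Automorphic
open _root_.Literature.NumberTheory.Automorphic.IdeleClassGroup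

/-! ## §1. Liu's pair labelling `(μ_V, μ_W)` (App. B) versus the HKS / Gan–Ichino labelling `(χ_V, χ_W)` -/

section Pair

variable (L : Type) [Field L] [NumberField L] [IsCMField L]

local notation3 "L⁺" => maximalRealSubfield L

/-- **Liu's "pair of splitting characters for `(V, W)`"**, AS PRINTED [Liu2021, App. B, the paragraph after
Remark B.3, arXiv p. 44 = TeX l. 4257]: "Let `V` … be a (non-degenerate) hermitian space over `E` … of rank `n`
and let `W` … be a (non-degenerate) skew-hermitian space over `E` … of rank `m`. … Let `μ = (μ_V, μ_W)` be a pair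
of splitting characters for `(V, W)`, that is, `(μ_V, μ_W)` is a pair of automorphic characters of `𝔸_E^×`
satisfying `μ_V|_{𝔸_F^×} = μ_{E/F}^m` and `μ_W|_{𝔸_F^×} = μ_{E/F}^n`. Then it induces an embedding
`ι_μ : G(𝔸_F) × H(𝔸_F) ↪ Mp(Res_{E/F} V ⊗_E W)`" (`G = U(V)`, `H = U(W)`).  Typed over the CM field `L` (`E = L`,
`F = L⁺`) with the tree's (1.5)-condition `IsSplittingChar L k μ` (`μ|_{𝕀_{L⁺}} = ε^k`): NOTE THE INDICES —
`μ_V` carries the parity of `m = rank W` and `μ_W` that of `n = rank V` (Liu indexes the character by the GROUP it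
splits; HKS (1.5) / GI §4.1 index it by the PARTNER space: `equivGI`).  Unitarity is recorded as a field, as in the
tree's `SplittingCharacters` (print: conjugate self-dual ⇒ strictly unitary, [Liu2021, Remark 4.2]).  A data
structure: nothing is asserted. [cite: Liu2021, App. B ¶ after Remark B.3, arXiv:2102.11518 p. 44] -/
structure SplittingPair (n m : ℕ) where
  /-- `μ_V`, the character splitting `G = U(V)` -/
  μV : HeckeCharacter L
  /-- `μ_V` is unitary -/
  μV_isUnitary : μV.IsUnitary
  /-- "`μ_V|_{𝔸_F^×} = μ_{E/F}^m`", `m = rank W` -/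
  μV_splitting : IsSplittingChar L m μV
  /-- `μ_W`, the character splitting `H = U(W)` -/
  μW : HeckeCharacter L
  /-- `μ_W` is unitary -/
  μW_isUnitary : μW.IsUnitary
  /-- "`μ_W|_{𝔸_F^×} = μ_{E/F}^n`", `n = rank V` -/
  μW_splitting : IsSplittingChar L n μW

namespace SplittingPair

variable {L} {n m : ℕ}

/-- **Liu → HKS / Gan–Ichino.**  [GanIchino2016, §4.1]: "a pair of characters `χ_V` and `χ_W` of `E^×` such that
`χ_V|_{F^×} = ω_{E/F}^{dim V}` and `χ_W|_{F^×} = ω_{E/F}^{dim W}`"; [HarrisKudlaSweet1996, (1.5) p. 951]: "If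
`dim_E V = m`, we choose a character `χ = χ_V` of `E^×` such that `χ_V|_{F^×} = ε^m_{E/F}`" — determining
"`ι̃_{V,χ_V} : G(W) → Mp(𝕎)`" (1.6), the splitting OF `G(W)`.  So Liu's `μ_V` (splits `U(V)`, parity `rank W`) is
GI's / HKS's `χ_W`, and Liu's `μ_W` is their `χ_V`: the map to the tree's `SplittingCharacters L n m`
(`dim V = n`, `dim W = m`) SWAPS the two slots. [cite: GanIchino2016, §4.1; HarrisKudlaSweet1996, (1.5)–(1.6) p. 951] -/
def toGI (P : SplittingPair L n m) : SplittingCharacters L n m where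
  χV := P.μW
  χV_isUnitary := P.μW_isUnitary
  χV_splitting := P.μW_splitting
  χW := P.μV
  χW_isUnitary := P.μV_isUnitary
  χW_splitting := P.μV_splitting

/-- **HKS / Gan–Ichino → Liu**: `(χ_V, χ_W) ↦ (μ_V, μ_W) := (χ_W, χ_V)`. [cite: GanIchino2016, §4.1; Liu2021, App. B
¶ after Remark B.3, arXiv p. 44] -/
def ofGI (S : SplittingCharacters L n m) : SplittingPair L n m where
  μV := S.χW
  μV_isUnitary := S.χW_isUnitary
  μV_splitting := S.χW_splitting
  μW := S.χV
  μW_isUnitary := S.χV_isUnitary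
  μW_splitting := S.χV_splitting

/-- Liu's `μ_W` is GI's `χ_V`. [cite: GanIchino2016, §4.1] -/
@[simp] theorem toGI_χV (P : SplittingPair L n m) : P.toGI.χV = P.μW := rfl

/-- Liu's `μ_V` is GI's `χ_W`. [cite: GanIchino2016, §4.1] -/
@[simp] theorem toGI_χW (P : SplittingPair L n m) : P.toGI.χW = P.μV := rfl

/-- GI's `χ_W` is Liu's `μ_V`. [cite: Liu2021, App. B ¶ after Remark B.3, arXiv p. 44] -/
@[simp] theorem ofGI_μV (S : SplittingCharacters L n m) : (ofGI S).μV = S.χW := rfl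

/-- GI's `χ_V` is Liu's `μ_W`. [cite: Liu2021, App. B ¶ after Remark B.3, arXiv p. 44] -/
@[simp] theorem ofGI_μW (S : SplittingCharacters L n m) : (ofGI S).μW = S.χV := rfl

/-- round trip. [cite: Liu2021, App. B ¶ after Remark B.3, arXiv p. 44; GanIchino2016, §4.1] -/
@[simp] theorem ofGI_toGI (P : SplittingPair L n m) : ofGI P.toGI = P := rfl

/-- round trip. [cite: GanIchino2016, §4.1; Liu2021, App. B ¶ after Remark B.3, arXiv p. 44] -/
@[simp] theorem toGI_ofGI (S : SplittingCharacters L n m) : (ofGI S).toGI = S := rfl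

/-- **The two labellings are equivalent data** (the swap). [cite: Liu2021, App. B ¶ after Remark B.3, arXiv p. 44; GanIchino2016, §4.1] -/
def equivGI : SplittingPair L n m ≃ SplittingCharacters L n m where
  toFun := toGI
  invFun := ofGI
  left_inv := ofGI_toGI
  right_inv := toGI_ofGI

/-- Pairs of splitting characters exist for every `(n, m)` (the tree's kernel `nonempty_splittingCharacters`, Weil's
extension of `ε_{L/L⁺}`). [cite: Liu2021, App. B ¶ after Remark B.3, arXiv p. 44; HarrisKudlaSweet1996, (1.5) p. 951] -/
theorem nonempty (n m : ℕ) : Nonempty (SplittingPair L n m) :=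
  (nonempty_splittingCharacters (L := L) n m).map ofGI

/-- **Gan–Ichino's recipe** [GanIchino2016, §4.1]: "One way to fix such a pair is simply to fix a character `χ` of
`E^×` such that `χ|_{F^×} = ω_{E/F}` and then set `χ_V = χ^{dim V}` and `χ_W = χ^{dim W}`" — in Liu's labelling
`μ_V = χ^m`, `μ_W = χ^n`. [cite: GanIchino2016, §4.1] -/
def ofOne (χ : HeckeCharacter L) (hu : χ.IsUnitary) (h : IsSplittingChar L 1 χ) (n m : ℕ) : SplittingPair L n m where
  μV := χ ^ m
  μV_isUnitary := SplittingCharacters.isUnitary_pow hu m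
  μV_splitting := by simpa using h.pow m
  μW := χ ^ n
  μW_isUnitary := SplittingCharacters.isUnitary_pow hu n
  μW_splitting := by simpa using h.pow n

/-- `ofOne` IS the tree's `SplittingCharacters.ofOne` read through the swap. [cite: GanIchino2016, §4.1] -/
theorem toGI_ofOne (χ : HeckeCharacter L) (hu : χ.IsUnitary) (h : IsSplittingChar L 1 χ) (n m : ℕ) :
    (ofOne χ hu h n m).toGI = SplittingCharacters.ofOne χ hu h n m := rfl

end SplittingPair

/-! ## §2. Liu's single character `μ` of App. D / Def. 4.11 (`μ|_{𝔸_F^×} = μ_{E/F}`) -/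

/-- **Liu's oscillator character condition** — [Liu2021, App. D §D.1 Step 2, arXiv p. 56]: "Choose a character
`μ : E^× → ℂ¹` such that `μ|_{F^×}` is the unique character whose kernel is exactly `N_{E/F}E^×`. Then we have the
induced homomorphism `ι_μ : U(V) → Mp(V_ε)` (see, for example, [HKS]*Section 1). Put `ω(μ, ε) := ω(ε) ∘ ι_μ`";
globally [Liu2021, Def. 4.11, arXiv p. 20]: "a conjugate symplectic automorphic character … `μ = ⊗μ_v`".  In the
tree's currency: `μ|_{𝕀_{L⁺}} = ε_{L/L⁺}`, i.e. `IsSplittingChar L 1 μ` — the `μ_V`-slot of a `SplittingPair L n 1`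
(READING: Step 1's `V_ε = (Res_{E/F} V, Tr_{E/F} ε( , )_V)` is `Res_{E/F}(V ⊗_E W₁)` for the skew-hermitian LINE
`W₁ = (E, ε x̄y)` in the normalisation of [GanIchino2016, §4.1], so `m = rank W₁ = 1`), whatever `n` is; an
abbreviation of the tree's predicate, no new object. [cite: Liu2021, App. D §D.1 Step 2, arXiv:2102.11518 p. 56; Liu2021, Definition 4.11, p. 20] -/
abbrev IsOscillatorChar (μ : HeckeCharacter L) : Prop := IsSplittingChar L 1 μ

variable {L}

/-- `μ|_{𝕀_{L⁺}} = ε_{L/L⁺}` spelled out. [cite: Liu2021, App. D §D.1 Step 2, arXiv p. 56] -/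
theorem isOscillatorChar_iff (μ : HeckeCharacter L) :
    IsOscillatorChar L μ ↔
      ∀ x : ideleGroup L⁺, μ (AdeleRing.ideleBaseChange L⁺ L x) = quadraticHeckeCharCM L x :=
  isSplittingChar_iff_of_odd odd_one μ

/-- **Liu's `μ` is CONJUGATE SYMPLECTIC** ([Liu2021, Def. 4.1]: "`μ|_{𝔸_F^×} = μ_{E/F}`"), in the tree's class-group
currency: for `ψ : C_L →ₜ* S¹`, `toHeckeCharacter ψ` is an oscillator character iff `IsConjugateSymplectic L ψ`.
[cite: Liu2021, Definition 4.1, arXiv p. 18; Liu2021, Definition 4.11, p. 20] -/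
theorem isOscillatorChar_toHeckeCharacter_iff (ψ : IdeleClassGroup L →ₜ* Circle) :
    IsOscillatorChar L (toHeckeCharacter L ψ) ↔ IsConjugateSymplectic L ψ :=
  isSplittingChar_toHeckeCharacter_iff_isConjugateSymplectic odd_one ψ

/-- a unitary oscillator character IS a conjugate symplectic character. [cite: Liu2021, Definition 4.11, arXiv p. 20] -/
theorem IsOscillatorChar.isConjugateSymplectic {μ : HeckeCharacter L} (hμ : μ.IsUnitary)
    (h : IsOscillatorChar L μ) : IsConjugateSymplectic L (unitaryClassChar L μ hμ) :=
  IsSplittingChar.isConjugateSymplectic odd_one hμ h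

/-- only the parity of the partner's rank matters: for ODD `k` the (1.5)-condition for `k` IS Liu's condition.
[cite: HarrisKudlaSweet1996, (1.5) p. 951] -/
theorem isSplittingChar_iff_isOscillatorChar_of_odd {k : ℕ} (hk : Odd k) (μ : HeckeCharacter L) :
    IsSplittingChar L k μ ↔ IsOscillatorChar L μ := by
  rw [isSplittingChar_iff_mod_two k μ, Nat.odd_iff.mp hk]

/-- for EVEN `k` the (1.5)-condition is `μ|_{𝕀_{L⁺}} = 1` (conjugate ORTHOGONAL), not Liu's condition.
[cite: HarrisKudlaSweet1996, (1.5) p. 951; Liu2021, Definition 4.1, arXiv p. 18] -/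
theorem isSplittingChar_iff_of_even' {k : ℕ} (hk : Even k) (μ : HeckeCharacter L) :
    IsSplittingChar L k μ ↔ IsSplittingChar L 0 μ := by
  rw [isSplittingChar_iff_mod_two k μ, Nat.even_iff.mp hk]

namespace SplittingPair

variable {n m : ℕ}

/-- **App. D's `μ` = App. B's `μ_V` for the pair `(V, W₁)`, `W₁` a skew-hermitian line** (`m = 1`), for every
rank `n` of `V`. [cite: Liu2021, App. D §D.1 Steps 1–2, arXiv p. 56] -/
theorem isOscillatorChar_μV (P : SplittingPair L n 1) : IsOscillatorChar L P.μV := P.μV_splitting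

/-- … and in the HKS / GI labelling it is `χ_{W₁}`, the character attached to the PARTNER line.
[cite: HarrisKudlaSweet1996, (1.5)–(1.6) p. 951; GanIchino2016, §4.1] -/
theorem toGI_χW_of_line (P : SplittingPair L n 1) : IsOscillatorChar L P.toGI.χW := P.μV_splitting

/-- For ODD `n = rank V` (the Picard case `n = 3`): `μ_W` is ALSO an oscillator (conjugate symplectic) character.
[cite: Liu2021, App. B ¶ after Remark B.3, arXiv p. 44] -/
theorem isOscillatorChar_μW_of_odd (hn : Odd n) (P : SplittingPair L n m) : IsOscillatorChar L P.μW :=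
  (isSplittingChar_iff_isOscillatorChar_of_odd hn P.μW).1 P.μW_splitting

/-- For ODD `m = rank W`: `μ_V` is an oscillator character. [cite: Liu2021, App. B ¶ after Remark B.3, arXiv p. 44] -/
theorem isOscillatorChar_μV_of_odd (hm : Odd m) (P : SplittingPair L n m) : IsOscillatorChar L P.μV :=
  (isSplittingChar_iff_isOscillatorChar_of_odd hm P.μV).1 P.μV_splitting

/-- For EVEN `m = rank W` (e.g. the pair `U(2,1) × U(1,1)`): `μ_V|_{𝕀_{L⁺}} = 1`, i.e. `μ_V` is conjugate
ORTHOGONAL — the two members of the pair then carry DIFFERENT conditions, and the index swap of `equivGI` is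
visible on the conditions. [cite: Liu2021, App. B ¶ after Remark B.3, arXiv p. 44; Liu2021, Definition 4.1, p. 18] -/
theorem isSplittingChar_zero_μV_of_even (hm : Even m) (P : SplittingPair L n m) : IsSplittingChar L 0 P.μV :=
  (isSplittingChar_iff_of_even' hm P.μV).1 P.μV_splitting

/-- the conjugate-orthogonal reading of the previous lemma in the class-group currency. [cite: Liu2021, Definition
4.1, arXiv p. 18] -/
theorem isConjugateOrthogonal_μV_of_even (hm : Even m) (P : SplittingPair L n m) :
    IsConjugateOrthogonal L (unitaryClassChar L P.μV P.μV_isUnitary) :=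
  P.μV_splitting.isConjugateOrthogonal hm P.μV_isUnitary

/-- the conjugate-symplectic reading for odd `m`. [cite: Liu2021, Definition 4.1, arXiv p. 18] -/
theorem isConjugateSymplectic_μV_of_odd (hm : Odd m) (P : SplittingPair L n m) :
    IsConjugateSymplectic L (unitaryClassChar L P.μV P.μV_isUnitary) :=
  P.μV_splitting.isConjugateSymplectic hm P.μV_isUnitary

end SplittingPair

/-- **The Picard pair `(n, m) = (3, 1)`** (`U(V) × U(W₁)`, `V` of rank 3, `W₁` a line): BOTH members of a Liu pair
are oscillator characters — the index swap Liu ↔ GI is invisible on the CONDITIONS (both are "restriction `= ε`"),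
though not on which character enters which splitting. [cite: Liu2021, App. B ¶ after Remark B.3, arXiv p. 44] -/
example (P : SplittingPair L 3 1) : IsOscillatorChar L P.μV ∧ IsOscillatorChar L P.μW :=
  ⟨P.isOscillatorChar_μV, P.isOscillatorChar_μW_of_odd (by decide)⟩

/-- **The pair `(n, m) = (3, 2)`**: `μ_V` is conjugate orthogonal, `μ_W` conjugate symplectic. [cite: Liu2021,
App. B ¶ after Remark B.3, arXiv p. 44] -/
example (P : SplittingPair L 3 2) : IsSplittingChar L 0 P.μV ∧ IsOscillatorChar L P.μW :=
  ⟨P.isSplittingChar_zero_μV_of_even (by decide), P.isOscillatorChar_μW_of_odd (by decide)⟩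

end Pair

/-! ## §3. Liu's `ε` (App. D Step 1) versus the tree's symplectic form `im_δ(h_V ⊗ h_W)` -/

section Epsilon

open _root_.Literature.RepresentationTheory.HeisenbergGroup
open UnitaryGroup UnitaryGroup.QuadraticCoordinates

variable {F E : Type*} [Field F] [Field E] [Algebra F E]

/-- **Liu's `ε` of the model.**  [Liu2021, App. D §D.1 Step 1, arXiv p. 56]: "Choose an element `ε ∈ E^{−×}/N_{E/F}E^×`.
Let `V_ε` be the underlying `F`-vector space of `V` equipped with the form `Tr_{E/F} ε( , )_V`, which becomes a
symplectic space."  The tree's dual-pair model (`UnitaryGroupSymplecticEmbedding`, `GelbartRogawski1991.UnitaryDualPair`)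
puts on `Res_{E/F}(V ⊗ W)` the alternating form `im_δ(h_V ⊗ h_W)` — the `δ`-coordinate of the hermitian pairing in
the quadratic coordinates `E = F ⊕ F δ`, `δ² = d` (`im_hermForm_map`).  For `W = ⟨a⟩` a hermitian LINE (`a ∈ F^×`),
`h_V ⊗ h_W = a · h_V` on `V ⊗ W = V`, and `a · im_δ(z) = Tr_{E/F}(ε z)` with THIS `ε`:
`ε(δ, d, a) := (a / 2d) · δ = a / (2δ)` (`epsilonOf_mul_add_conj`).  So the model's symplectic space IS Liu's `V_ε`
for `ε = a/(2δ)` — as forms, on the nose (`algebraMap_alt_polar_eq_trace`). [cite: Liu2021, App. D §D.1 Step 1,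
arXiv:2102.11518 p. 56] -/
def epsilonOf (δ : E) (d a : F) : E :=
  algebraMap F E (a / (2 * d)) * δ

/-- `ε ∈ E^−`: `c ε = −ε` for the conjugation `c` (`c δ = −δ`). [cite: Liu2021, App. D §D.1 Step 1, arXiv p. 56] -/
theorem conj_epsilonOf (c : E ≃ₐ[F] E) {δ : E} (hcδ : c δ = -δ) (d a : F) :
    c (epsilonOf δ d a) = -epsilonOf δ d a := by
  rw [epsilonOf, map_mul, AlgEquiv.commutes, hcδ, mul_neg]

/-- `ε ≠ 0` for `a ≠ 0` (`δ ≠ 0`, `d ≠ 0`, characteristic `0`): `ε ∈ E^{−×}`. [cite: Liu2021, App. D §D.1 Step 1, arXiv p. 56] -/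
theorem epsilonOf_ne_zero [CharZero F] {δ : E} (hδ : δ ≠ 0) {d a : F} (hd : d ≠ 0) (ha : a ≠ 0) :
    epsilonOf δ d a ≠ 0 := by
  refine mul_ne_zero ?_ hδ
  rw [map_ne_zero_iff _ (algebraMap F E).injective]
  exact div_ne_zero ha (mul_ne_zero two_ne_zero hd)

/-- `ε · 2δ = a`, i.e. `ε = a / (2δ)` (`δ² = d`). [cite: Liu2021, App. D §D.1 Step 1, arXiv p. 56] -/
theorem epsilonOf_mul_two_mul_delta [CharZero F] {δ : E} {d : F} (hδd : δ * δ = algebraMap F E d) (hd : d ≠ 0)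
    (a : F) : epsilonOf δ d a * (2 * δ) = algebraMap F E a := by
  have h2 : (2 : E) = algebraMap F E 2 := (map_ofNat (algebraMap F E) 2).symm
  calc epsilonOf δ d a * (2 * δ) = algebraMap F E (a / (2 * d)) * 2 * (δ * δ) := by rw [epsilonOf]; ring
    _ = algebraMap F E (a / (2 * d) * 2 * d) := by rw [hδd, h2, ← map_mul, ← map_mul]
    _ = algebraMap F E a := by rw [div_mul_eq_mul_div, div_mul_eq_mul_div, mul_assoc, mul_div_assoc,
          div_self (mul_ne_zero two_ne_zero hd), mul_one]

/-- scaling the line: `ε(δ, d, a) = a · ε(δ, d, 1)`. [cite: Liu2021, App. D §D.1 Step 1, arXiv p. 56] -/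
theorem epsilonOf_eq_mul_one (δ : E) (d a : F) : epsilonOf δ d a = algebraMap F E a * epsilonOf δ d 1 := by
  rw [epsilonOf, epsilonOf, ← mul_assoc, ← map_mul, mul_one_div]

/-- scaling the line: `ε(δ, d, a) · z = ε(δ, d, 1) · (a z)`. [cite: Liu2021, App. D §D.1 Step 1, arXiv p. 56] -/
theorem epsilonOf_mul (δ : E) (d a : F) (z : E) :
    epsilonOf δ d a * z = epsilonOf δ d 1 * (algebraMap F E a * z) := by
  rw [epsilonOf_eq_mul_one]
  ring

/-- **`Tr_{E/F}(ε z) = a · im_δ(z)`**: Liu's Step-1 form `Tr_{E/F} ε( , )` on the line-scaled pairing is the tree's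
`δ`-coordinate form (from the tree's `trace_delta_mul`: `δ z + c(δ z) = 2d · im z`).
[cite: Liu2021, App. D §D.1 Step 1, arXiv p. 56] -/
theorem epsilonOf_mul_add_conj [CharZero F] {Ψ : (F × F) ≃+ E} {δ : E} {d : F}
    (h : IsQuadraticCoordinates (algebraMap F E) Ψ δ d) (hd : d ≠ 0) (c : E ≃ₐ[F] E) (hcδ : c δ = -δ)
    (a : F) (z : E) :
    epsilonOf δ d a * z + c (epsilonOf δ d a * z) = algebraMap F E (a * im Ψ z) := by
  have ht := h.trace_delta_mul (σ := (c : E →+* E)) (fun x => c.commutes x) hcδ z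
  have ht' : δ * z + c (δ * z) = algebraMap F E (2 * d * im Ψ z) := ht
  rw [epsilonOf, mul_assoc, map_mul, AlgEquiv.commutes, ← mul_add, ht', ← map_mul]
  congr 1
  rw [← mul_assoc, div_mul_cancel₀ _ (mul_ne_zero two_ne_zero hd)]

/-- **THE FORM IDENTITY.**  For an `F`-rational symmetric Gram matrix `T` (the tree's frames `J = T ⊗ 1`) and vectors
`x, y ∈ E^N`: the tree's symplectic pairing `alt (polar β_T) (reIm x) (reIm y)` of `Res_{E/F} E^N` — the form of
`UnitaryGroup.toSymplectic` / `GelbartRogawski1991.UnitaryDualPair.splittingDatum` — read in `E`, EQUALS Liu's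
`Tr_{E/F}(ε · h_T(x, y))` with `ε = ε(δ, d, 1) = 1/(2δ)`; with `T := a • T_V` (the pair `(V, ⟨a⟩)`) and `epsilonOf_mul`
this is `Tr_{E/F}(ε(δ, d, a) · h_{T_V}(x, y))`, Liu's `V_ε` (the model's Gram matrix of `V ⊗ ⟨a⟩` is `a • T_V` up to the
re-indexing `e : Fin N × Fin 1 ≃ Fin n` of `GelbartRogawski1991.UnitaryDualPair.adelicGram`, which does not change the
form; the statement is over the RATIONAL points `E^N`, whose base change carries the model's `splittingDatum`).
[cite: Liu2021, App. D §D.1 Step 1, arXiv p. 56; GelbartRogawski1991, §3.1 p. 454] -/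
theorem algebraMap_alt_polar_eq_trace [CharZero F] {Ψ : (F × F) ≃+ E} {δ : E} {d : F}
    (h : IsQuadraticCoordinates (algebraMap F E) Ψ δ d) (hd : d ≠ 0) (c : E ≃ₐ[F] E) (hcδ : c δ = -δ)
    {N : Type*} [Fintype N] [DecidableEq N] {T : Matrix N N F} (hT : T.IsSymm) (x y : N → E) :
    algebraMap F E (alt (polar (Matrix.toLinearMap₂' F T)) (reIm Ψ N x) (reIm Ψ N y)) =
      epsilonOf δ d 1 * hermForm (c : E →+* E) (T.map (algebraMap F E)) x y +
        c (epsilonOf δ d 1 * hermForm (c : E →+* E) (T.map (algebraMap F E)) x y) := by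
  rw [← h.im_hermForm_map N hT (σ := (c : E →+* E)) (fun t => c.commutes t) hcδ x y,
    epsilonOf_mul_add_conj h hd c hcδ 1, one_mul]

/-- the same for the line-scaled Gram matrix `a • T` (`V ⊗ ⟨a⟩`): the tree's form is `Tr_{E/F}(ε(δ, d, a) · h_T(x, y))`.
[cite: Liu2021, App. D §D.1 Step 1, arXiv p. 56] -/
theorem algebraMap_alt_polar_smul_eq_trace [CharZero F] {Ψ : (F × F) ≃+ E} {δ : E} {d : F}
    (h : IsQuadraticCoordinates (algebraMap F E) Ψ δ d) (hd : d ≠ 0) (c : E ≃ₐ[F] E) (hcδ : c δ = -δ)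
    {N : Type*} [Fintype N] [DecidableEq N] {T : Matrix N N F} (hT : T.IsSymm) (a : F) (x y : N → E) :
    algebraMap F E (alt (polar (Matrix.toLinearMap₂' F (a • T))) (reIm Ψ N x) (reIm Ψ N y)) =
      epsilonOf δ d a * hermForm (c : E →+* E) (T.map (algebraMap F E)) x y +
        c (epsilonOf δ d a * hermForm (c : E →+* E) (T.map (algebraMap F E)) x y) := by
  have hTa : (a • T).IsSymm := hT.smul a
  have hmap : (a • T).map (algebraMap F E) = algebraMap F E a • T.map (algebraMap F E) := by
    ext i j
    simp only [Matrix.map_apply, Matrix.smul_apply, smul_eq_mul, map_mul]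
  have hform : hermForm (c : E →+* E) ((a • T).map (algebraMap F E)) x y =
      algebraMap F E a * hermForm (c : E →+* E) (T.map (algebraMap F E)) x y := by
    rw [hmap, hermForm_apply, hermForm_apply, Matrix.smul_mulVec, dotProduct_smul, smul_eq_mul]
  rw [algebraMap_alt_polar_eq_trace h hd c hcδ hTa x y, hform, ← epsilonOf_mul]

end Epsilon

/-! ## §4. Liu's `χ` (App. D Step 3) AT THE TREE'S MODEL `ω_ψ ∘ (s_pair ⊗ η)` of the CM dual pair -/

section Model

open _root_.Literature.NumberTheory.GelbartRogawski1991
open _root_.Literature.NumberTheory.GelbartRogawski1991.UnitaryDualPair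
open _root_.Literature.RepresentationTheory.CentralCharacterQuotient

variable (L : Type) [Field L] [NumberField L] [IsCMField L] {N M n : ℕ} (e : Fin N × Fin M ≃ Fin n)
variable (dV : Fin N → L) (hdV : ∀ i, IsCMField.complexConj L (dV i) = dV i) (hdV0 : ∀ i, dV i ≠ 0)
variable (dW : Fin M → L) (hdW : ∀ i, IsCMField.complexConj L (dW i) = dW i) (hdW0 : ∀ i, dW i ≠ 0)

/-- **the anti-diagonal centre** `u ↦ (u · 1_V, u⁻¹ · 1_W)` of `U(diag dV)(𝔸_{L⁺}) × U(diag dW)(𝔸_{L⁺})`, as a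
homomorphism out of `U(1)(𝔸_{L⁺})` (the kernel of the dual-pair map to `Sp(𝕎_𝔸)`: both scalars act on `V ⊗ W` by
`u u⁻¹ = 1`; tree `UnitaryGroup.adelicInl_adelicCenter_mul_adelicInr_adelicCenter_inv`). [cite: Mok2014, §1 Notation p. 5] -/
def antiDiag : CMAdelicOne L →* CMAdelic L dV × CMAdelic L dW :=
  (CMCenter L dV).prod ((CMCenter L dW).comp invMonoidHom)

/-- formula. [cite: Mok2014, §1 Notation p. 5] -/
@[simp] theorem antiDiag_apply (u : CMAdelicOne L) :
    antiDiag L dV dW u = (CMCenter L dV u, CMCenter L dW u⁻¹) := rfl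

/-- **`η_Z := η ∘ (anti-diagonal)`**: the central character ON `Z⁻` of the model normalised by `η`
([GelbartRogawski1991, Remark p. 457]: compatible splittings differ by central characters; the tree's
`cmPairSplittingTwist = s_pair ⊗ η`).  It is the `β` of the tree's hypothesis-predicate `CenterCharEq η β`, now a
FUNCTION of `η` (`centerCharEq_centerTwist`). [cite: GelbartRogawski1991, §3.1 Remark p. 457 L4–13] -/
def centerTwist (η : CMAdelic L dV × CMAdelic L dW →* ℂˣ) : CMAdelicOne L →* ℂˣ :=
  η.comp (antiDiag L dV dW)

/-- formula: `η_Z(u) = η(u · 1_V, u⁻¹ · 1_W)`. [cite: GelbartRogawski1991, §3.1 Remark p. 457 L4–13] -/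
@[simp] theorem centerTwist_apply (η : CMAdelic L dV × CMAdelic L dW →* ℂˣ) (u : CMAdelicOne L) :
    centerTwist L dV dW η u = η (CMCenter L dV u, CMCenter L dW u⁻¹) := rfl

/-- the tree's constraint `CenterCharEq η β` holds TAUTOLOGICALLY for `β := η_Z`. [cite: GelbartRogawski1991, §3.1 Remark p. 457 L4–13] -/
theorem centerCharEq_centerTwist (η : CMAdelic L dV × CMAdelic L dW →* ℂˣ) :
    CenterCharEq L dV dW η (centerTwist L dV dW η) := fun _ => rfl

/-- … and `CenterCharEq η β` says exactly `η_Z = β`. [cite: GelbartRogawski1991, §3.1 Remark p. 457 L4–13] -/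
theorem centerCharEq_iff (η : CMAdelic L dV × CMAdelic L dW →* ℂˣ) (β : CMAdelicOne L →* ℂˣ) :
    CenterCharEq L dV dW η β ↔ centerTwist L dV dW η = β :=
  ⟨fun h => MonoidHom.ext h, fun h u => by rw [← h]; rfl⟩

variable (hGR : (cmSplittingDatum L e dV hdV hdV0 dW hdW hdW0).CompatibleSplitting)
variable (η : CMAdelic L dV × CMAdelic L dW →* ℂˣ)

/-- **THE CENTRE OF `U(V)` ACTS AS THE CENTRE OF `U(W)` TWISTED BY `η_Z`** in the model
`ρ = ω_ψ ∘ (s_pair ⊗ η)`: `ρ(u · 1_V, 1) = η_Z(u) • ρ(1, u · 1_W)` — because `(u · 1_V, 1) = (u · 1_V, u⁻¹ · 1_W) · (1, u · 1_W)`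
and `ρ` is the scalar `η_Z(u)` on the anti-diagonal centre (tree `cmPairRepTwist_center`).  This is the kernel half
of the dictionary between Liu's Step 3 ("maximal quotient … with central character `χ`" for the centre `E¹ ⊂ U(V)`)
and the theta-lift indexing by characters `χ′` of `U(W₁)(𝔸) = 𝔸_E^1` (`W₁` a line): `χ = χ′ · η_Z`. [cite: Liu2021, App. D §D.1 Step 3, arXiv p. 56;
GelbartRogawski1991, §3.1 Remark p. 457 L4–13] -/
theorem cmPairRepTwist_centerV (u : CMAdelicOne L) (Φ : CMSchwartz L n) :
    cmPairRepTwist L e dV hdV hdV0 dW hdW hdW0 hGR η (CMCenter L dV u, 1) Φ =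
      ((centerTwist L dV dW η u : ℂˣ) : ℂ) •
        cmPairRepTwist L e dV hdV hdV0 dW hdW hdW0 hGR η (1, CMCenter L dW u) Φ := by
  have hmul : ((CMCenter L dV u, 1) : CMAdelic L dV × CMAdelic L dW) =
      (CMCenter L dV u, CMCenter L dW u⁻¹) * (1, CMCenter L dW u) := by
    rw [Prod.mk_mul_mk, mul_one, ← map_mul, inv_mul_cancel, map_one]
  rw [hmul, map_mul, Module.End.mul_apply, cmPairRepTwist_center, centerTwist_apply]

/-- the same with the un-normalised Gelbart–Rogawski splitting (`η = 1`): the two centres act by THE SAME operators.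
[cite: Liu2021, App. D §D.1 Step 3, arXiv p. 56; GelbartRogawski1991, §3.1 Prop. 3.1.1 p. 455] -/
theorem cmPairRepTwist_centerV_one (u : CMAdelicOne L) (Φ : CMSchwartz L n) :
    cmPairRepTwist L e dV hdV hdV0 dW hdW hdW0 hGR 1 (CMCenter L dV u, 1) Φ =
      cmPairRepTwist L e dV hdV hdV0 dW hdW hdW0 hGR 1 (1, CMCenter L dW u) Φ := by
  rw [cmPairRepTwist_centerV, centerTwist_apply, MonoidHom.one_apply, Units.val_one, one_smul]

/-- **STEP 3 ↔ THETA-LIFT INDEX.**  Liu's `χ`-augmentation of the model restricted to `U(V)(𝔸)` (the span of the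
`ρ(u · 1_V)Φ − χ(u)Φ`, whose quotient is "the maximal quotient … with central character `χ`", [Liu2021, App. D
§D.1 Step 3]) EQUALS the `(χ · η_Z⁻¹)`-augmentation of the model restricted to `U(W)(𝔸)` along its centre: the
maximal quotient of `ω_ψ ∘ (s_pair ⊗ η)` on which `Z(U(V))(𝔸)` acts by `χ` IS the maximal quotient on which
`Z(U(W))(𝔸)` acts by `χ′ = χ · η_Z⁻¹`. [cite: Liu2021, App. D §D.1 Step 3, arXiv:2102.11518 p. 56] -/
theorem augmentation_centerV_eq (χ : CMAdelicOne L →* ℂˣ) :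
    augmentation ((cmPairRepTwist L e dV hdV hdV0 dW hdW hdW0 hGR η).comp (MonoidHom.inl _ _)) (CMCenter L dV) χ =
      augmentation ((cmPairRepTwist L e dV hdV hdV0 dW hdW hdW0 hGR η).comp (MonoidHom.inr _ _)) (CMCenter L dW)
        (χ * (centerTwist L dV dW η)⁻¹) := by
  unfold augmentation
  refine iSup_congr fun u => ?_
  have hs : ((centerTwist L dV dW η u : ℂˣ) : ℂ) * (((χ * (centerTwist L dV dW η)⁻¹) u : ℂˣ) : ℂ) =
      ((χ u : ℂˣ) : ℂ) := by
    rw [← Units.val_mul, mul_comm, MonoidHom.mul_apply, MonoidHom.inv_apply, inv_mul_cancel_right]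
  have key : (cmPairRepTwist L e dV hdV hdV0 dW hdW hdW0 hGR η).comp (MonoidHom.inl _ _) (CMCenter L dV u) -
        ((χ u : ℂˣ) : ℂ) • LinearMap.id =
      ((centerTwist L dV dW η u : ℂˣ) : ℂ) •
        ((cmPairRepTwist L e dV hdV hdV0 dW hdW hdW0 hGR η).comp (MonoidHom.inr _ _) (CMCenter L dW u) -
          (((χ * (centerTwist L dV dW η)⁻¹) u : ℂˣ) : ℂ) • LinearMap.id) := by
    refine LinearMap.ext fun Φ => ?_
    show cmPairRepTwist L e dV hdV hdV0 dW hdW hdW0 hGR η (CMCenter L dV u, 1) Φ - ((χ u : ℂˣ) : ℂ) • Φ =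
      ((centerTwist L dV dW η u : ℂˣ) : ℂ) •
        (cmPairRepTwist L e dV hdV hdV0 dW hdW hdW0 hGR η (1, CMCenter L dW u) Φ -
          (((χ * (centerTwist L dV dW η)⁻¹) u : ℂˣ) : ℂ) • Φ)
    rw [cmPairRepTwist_centerV, smul_sub, smul_smul, hs]
  rw [key, LinearMap.range_smul _ _ (Units.ne_zero _)]

/-- for the un-normalised Gelbart–Rogawski splitting (`η = 1`): Liu's `χ` IS the `U(W)`-central character `χ′`, on the
nose. [cite: Liu2021, App. D §D.1 Step 3, arXiv p. 56] -/
theorem augmentation_centerV_eq_one (χ : CMAdelicOne L →* ℂˣ) :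
    augmentation ((cmPairRepTwist L e dV hdV hdV0 dW hdW hdW0 hGR 1).comp (MonoidHom.inl _ _)) (CMCenter L dV) χ =
      augmentation ((cmPairRepTwist L e dV hdV hdV0 dW hdW hdW0 hGR 1).comp (MonoidHom.inr _ _)) (CMCenter L dW) χ := by
  rw [augmentation_centerV_eq]
  congr 1
  ext u
  simp [centerTwist]

/-- **Liu's Step 3 AT THE MODEL**: "Let `ω(μ, ε, χ)` be the maximal quotient of the representation `ω(ε, μ)` of `U(V)`
with central character `χ`" — the tree's `CentralCharacterQuotient.quotRep` of the model `ω_ψ ∘ (s_pair ⊗ η)` restricted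
to `U(diag dV)(𝔸_{L⁺})`, along its centre `u ↦ u · 1_V` (central by `UnitaryGroup.adelicCenter_mem_center`), for a
character `χ` of `U(1)(𝔸_{L⁺})`.  (Liu's `ω(μ, ε, χ)` is the FINITE-adelic representation `⊗'_{v ∤ ∞}`, [Liu2021,
Def. 4.11]; this is the same operation on the full adelic model — see the module docstring, entry (χ).)
[cite: Liu2021, App. D §D.1 Step 3, arXiv:2102.11518 p. 56; Liu2021, Definition 4.11, p. 20] -/
def modelCentralQuotientRep (χ : CMAdelicOne L →* ℂˣ) :
    Representation ℂ (CMAdelic L dV)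
      (CMSchwartz L n ⧸
        augmentation ((cmPairRepTwist L e dV hdV hdV0 dW hdW hdW0 hGR η).comp (MonoidHom.inl _ _)) (CMCenter L dV) χ) :=
  quotRep ((cmPairRepTwist L e dV hdV hdV0 dW hdW hdW0 hGR η).comp (MonoidHom.inl _ _))
    (fun u => UnitaryGroup.adelicCenter_mem_center _ _ _ _ _ u) χ

/-- on Liu's quotient the centre of `U(V)(𝔸)` acts through `χ` (tree `quotRep_zeta`). [cite: Liu2021, App. D §D.1
Step 3, arXiv p. 56] -/
theorem modelCentralQuotientRep_center (χ : CMAdelicOne L →* ℂˣ) (u : CMAdelicOne L)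
    (w : CMSchwartz L n ⧸
      augmentation ((cmPairRepTwist L e dV hdV hdV0 dW hdW hdW0 hGR η).comp (MonoidHom.inl _ _)) (CMCenter L dV) χ) :
    modelCentralQuotientRep L e dV hdV hdV0 dW hdW hdW0 hGR η χ (CMCenter L dV u) w = ((χ u : ℂˣ) : ℂ) • w :=
  quotRep_zeta _ _ χ u w

/-- **the kernel of Liu's quotient map is the `U(W)`-side `(χ · η_Z⁻¹)`-augmentation**: a linear functional on the
model (e.g. a theta-period functional) factors through Liu's `ω(μ, ε, χ)`-quotient iff it kills the
`ρ(1, u · 1_W)Φ − (χ η_Z⁻¹)(u)Φ` — the `U(W)`-central character it must transform by is `χ′ = χ · η_Z⁻¹`.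
[cite: Liu2021, App. D §D.1 Step 3, arXiv p. 56] -/
theorem ker_mkQ_centerV_eq (χ : CMAdelicOne L →* ℂˣ) :
    LinearMap.ker
        (augmentation ((cmPairRepTwist L e dV hdV hdV0 dW hdW hdW0 hGR η).comp (MonoidHom.inl _ _))
          (CMCenter L dV) χ).mkQ =
      augmentation ((cmPairRepTwist L e dV hdV hdV0 dW hdW hdW0 hGR η).comp (MonoidHom.inr _ _)) (CMCenter L dW)
        (χ * (centerTwist L dV dW η)⁻¹) := by
  rw [Submodule.ker_mkQ, augmentation_centerV_eq]

end Model

/-! ## §5. The `example`s of record: the model's `ω` read in Liu's parametrisation `(μ, ε, χ)` -/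

section Examples

open _root_.Literature.NumberTheory.GelbartRogawski1991.UnitaryDualPair
open _root_.Literature.RepresentationTheory.CentralCharacterQuotient

variable (L : Type) [Field L] [NumberField L] [IsCMField L] {n : ℕ} (e : Fin 3 × Fin 1 ≃ Fin n)
variable (dV : Fin 3 → L) (hdV : ∀ i, IsCMField.complexConj L (dV i) = dV i) (hdV0 : ∀ i, dV i ≠ 0)
variable (a : Fin 1 → L) (ha : ∀ i, IsCMField.complexConj L (a i) = a i) (ha0 : ∀ i, a i ≠ 0)
variable (hGR : (cmSplittingDatum L e dV hdV hdV0 a ha ha0).CompatibleSplitting)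

/-- **N-i1-match, (χ)-slot, at the Picard pair `U(V₃) × U(W₁)`** (`V₃ = diag dV` of rank 3, `W₁ = ⟨a⟩` a hermitian
line, the un-normalised Gelbart–Rogawski pair splitting): the maximal quotient of the model `ω_ψ ∘ s_pair` on which the
centre of `U(V₃)(𝔸)` acts by `χ` — Liu's `ω(μ, ε, χ)`-operation [App. D Step 3] — is the maximal quotient on which
`U(W₁)(𝔸)`'s centre acts by the SAME `χ` (the theta lift of `χ`). [cite: Liu2021, App. D §D.1 Step 3, arXiv p. 56] -/
example (χ : CMAdelicOne L →* ℂˣ) :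
    augmentation ((cmPairRepTwist L e dV hdV hdV0 a ha ha0 hGR 1).comp (MonoidHom.inl _ _)) (CMCenter L dV) χ =
      augmentation ((cmPairRepTwist L e dV hdV hdV0 a ha ha0 hGR 1).comp (MonoidHom.inr _ _)) (CMCenter L a) χ :=
  augmentation_centerV_eq_one L e dV hdV hdV0 a ha ha0 hGR χ

/-- **… and for a `K_∞`-normalised splitting `s_pair ⊗ η`** the `U(W₁)`-character is `χ · η_Z⁻¹`.
[cite: Liu2021, App. D §D.1 Step 3, arXiv p. 56; GelbartRogawski1991, §3.1 Remark p. 457 L4–13] -/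
example (η : CMAdelic L dV × CMAdelic L a →* ℂˣ) (χ : CMAdelicOne L →* ℂˣ) :
    augmentation ((cmPairRepTwist L e dV hdV hdV0 a ha ha0 hGR η).comp (MonoidHom.inl _ _)) (CMCenter L dV) χ =
      augmentation ((cmPairRepTwist L e dV hdV hdV0 a ha ha0 hGR η).comp (MonoidHom.inr _ _)) (CMCenter L a)
        (χ * (centerTwist L dV a η)⁻¹) :=
  augmentation_centerV_eq L e dV hdV hdV0 a ha ha0 hGR η χ

/-- **N-i1-match, (μ)-slot at the level of CONDITIONS**: the splitting characters of the Picard pair in Liu's labelling,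
`(μ_V, μ_W) ∈ SplittingPair L 3 1`, are BOTH oscillator (conjugate symplectic) characters, and Liu's App. D `μ` is
`μ_V` = HKS/GI's `χ_{W₁}`. [cite: Liu2021, App. D §D.1 Step 2, arXiv p. 56; HarrisKudlaSweet1996, (1.5) p. 951] -/
example (P : SplittingPair L 3 1) :
    IsOscillatorChar L P.μV ∧ IsOscillatorChar L P.toGI.χW ∧ P.toGI.χW = P.μV ∧ IsOscillatorChar L P.μW :=
  ⟨P.isOscillatorChar_μV, P.toGI_χW_of_line, rfl, P.isOscillatorChar_μW_of_odd (by decide)⟩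

end Examples

end Literature.RepresentationTheory.Liu2021

end
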